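import Summits.Ventures.CertifiedQuantumChemistry.Rows.HubbardRingTVGroundStateEnergyPerSite
import Summits.Ventures.CertifiedQuantumChemistry.Rows.HubbardRingTVHoppingBounds
import Summits.Ventures.CertifiedQuantumChemistry.Rows.HubbardRingTVHoppingMonotone
import Literature.MathematicalPhysics.QuantumChemistry.RelaxationRealRestriction
import HarnessLib

/-!
# Ventures/CertifiedQuantumChemistry — Rows/HubbardRingTVBondSupergradient.lean: THE BOND READING AS A
# SUPERGRADIENT — on the TV-H ring (`L ≥ 3`) `−2×` the bond sum of an optimal pair is a supergradient of
# `t ↦ OPT_X(L; t, U)`; optimal bond sums are non-decreasing in `t` and have the sign of `t` (even `L`);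
# the exact twin: Feynman–Hellmann in `t` for the half-filled ground state, `B` non-decreasing in `t`

HONEST FRAMING (verbatim): certified bounds for a stated model Hamiltonian in a stated basis; not a
claim about the real molecule beyond that model. Nothing here is a state of record, a row, a claim node
or a value of record; the statements are about the optimal values `OPT_DQG` / `OPT_DQG+S²`
(`Model.pqgSectorEnergy` / `Model.pqgSingletEnergy`) of the cell's Hubbard-ring test-vector tables
`hubbardRingTV L t U`, about ARBITRARY optimal feasible pairs of those programmes, and about the exact
half-filled ground state; no certified primal point of any file is asserted to exist or read.

Seat rdm-B, ROWS courtesy file (theorems only; no `def`, no notation, no instance; zero compute). The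
`t`-TWIN of gen 36's `Rows/HubbardRingTVDoublonSupergradient.lean` (the DOUBLON reading: the total doublon
weight of an optimal pair is a supergradient of `U ↦ OPT_X`). HOME/STRUCTURE.md §2.2.8 (i) writes the
ring Hamiltonian as `H(t, U) = t·Â + U·D̂` and reads every feasible pair through the two linear
functionals `(⟨D̂⟩, ⟨Â⟩)` (the "shadow set"); with this gen's ring energy formula
(`Rows/HubbardRingTVEnergyFormula.lean`: `Re E_{t,U}(γ, Γ) = −2t·K(γ) + U·s(Γ)` for `L ≥ 3`, `K(γ) := Σ_p Σ_σ
Re γ_{pσ,(p+1)σ}` the BOND SUM, `s(Γ)` the doublon weight) the `t`-derivative of the functional at a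
pair is `⟨Â⟩ = −2K(γ)`, and Danskin's elementary half — the derivative of the active affine function is
a supergradient of the minimum — gives the bond reading:

* §1 `hubbardRingTV_re_rdmEnergy_sub_hopping_eq` — `Re E_{t′,U} − Re E_{t,U} = −2(t′ − t)·K(γ)` for a
  Hermitian `γ` and any `Γ` (`L ≥ 3`; gen 37's `hubbardRingTV_rdmEnergy_sub_hopping` + the formula).
* §2 **THE SUPERGRADIENT INEQUALITY IN `t`**: at a pair feasible for the `(a, b)` sector programme and
  OPTIMAL at `t`, for EVERY `t′`: `OPT_DQG(L; t′, U; a, b) ≤ OPT_DQG(L; t, U; a, b) − 2(t′ − t)·K(γ)`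
  (`hubbardRingTV_pqgSectorEnergy_le_sub_mul_bond`); singlet level likewise
  (`hubbardRingTV_pqgSingletEnergy_le_sub_mul_bond`); the one-sided difference quotients:
  `∂⁺_t OPT ≤ −2K(γ*) ≤ ∂⁻_t OPT` (`hubbardRingTV_pqgSectorEnergy_tslope_le` / `hubbardRingTV_le_pqgSectorEnergy_tslope`).
* §3 CONSEQUENCES: **`hubbardRingTV_optimal_bond_monotone`** — for optimal pairs `γ` at `t` and `γ′` at
  `t′ > t` (same `U`, same sector), `K(γ) ≤ K(γ′)` (supergradients of a concave function are monotone);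
  **`hubbardRingTV_optimal_mul_bond_nonneg`** — on the EVEN ring, `0 ≤ t·K(γ*)` at every optimal pair
  (supergradient towards `t′ = 0` and gen 37's `OPT_DQG(L; t, U) ≤ OPT_DQG(L; 0, U)`, the sublattice gauge);
  `hubbardRingTV_exists_optimal_bond_supergradient` — an optimal pair exists and satisfies §2 for all `t′`.
* §4 THE EXACT TWIN on the half-filled even ring `L = 2n ≥ 4` (`t ≠ 0`, `U > 0`):
  `hubbardRingTV_groundState_expect_hopping_pencil` (`⟨ψ, H(t′,U) ψ⟩ = ⟨ψ, H(t,U) ψ⟩ − (t′ − t)·2n·4·B`,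
  `B = ⟨c†_{p₀σ₀} c_{(p₀+1)σ₀}⟩_ψ` at any site / spin); **`hubbardRingTV_energy_le_sub_mul_bond`** —
  Feynman–Hellmann: `E₀(2n; t′, U; n, n) ≤ E₀(2n; t, U; n, n) − (t′ − t)·8n·Re B` for a unit ground state
  at `t` (a trial state at `t′` in the `(n, n)` sector, Lieb); **`hubbardRingTV_groundState_bond_monotone`**
  — for unit ground states at `t < t′`, `Re B(t) ≤ Re B(t′)`: the ground-state bond amplitude is
  NON-DECREASING in the hopping at fixed `U` (its sign is that of `t`, sibling's
  `hubbardRingTV_groundState_mul_bond_nonneg`).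

Everything is PROVED (0 sorry), standard axioms; no definitions, no named facts; no claim node, hint, row
or CERTIFIED cell depends on it. References (docstring-only): J. M. Danskin, *The Theory of Max-Min*
(Springer 1967) ch. I; R. T. Rockafellar, *Convex Analysis* (1970) §24 (monotone supergradients);
R. P. Feynman, Phys. Rev. 56 (1939) 340 (Hellmann–Feynman). Tree (REUSED): `hubbardRingTV_rdmEnergy_sub_hopping`
(gen 37), `hubbardRingTV_pqgSectorEnergy_le_zero_hopping` (gen 37), `RingEnergy.hubbardRingTV_oneBody_eq` /
`re_bond_add_bond_of_isHermitian` / `hubbardRingTV_expect_eq` / `hubbardRingTV_groundEnergy_eq_energy` (this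
gen), `hubbardRingTV_groundState_bond_eq` / `…_bond_reverse` / `hubbardRingTV_groundState_isInSector` (gen 38),
`pqgSectorEnergy_le_rdmEnergy`, `pqgSingletEnergy_le_rdmEnergy`,
`exists_isDQGFeasibleSector_rdmEnergy_eq_pqgSectorEnergy`, `sectorGroundEnergy_le_of_rayleigh`.
-/

noncomputable section

namespace Summit.Ventures.CertifiedQuantumChemistry

open Matrix Finset
open Literature.MathematicalPhysics.QuantumLattice Literature.MathematicalPhysics.QuantumChemistry
open Summit.Ventures.CertifiedQuantumChemistry.Hamiltonians
open scoped ComplexOrder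

namespace RingEnergy

open RingSymmetry

/-! ## §1 The functional along the hopping: `Re E_{t′} − Re E_t = −2(t′ − t)·K(γ)`, `K` the bond sum -/

section Functional

variable {L : ℕ} {γ : Matrix (Orb (Fin L)) (Orb (Fin L)) ℂ}
  {Γ : Matrix (Orb (Fin L) × Orb (Fin L)) (Orb (Fin L) × Orb (Fin L)) ℂ}

/-- **THE `t`-DERIVATIVE OF THE FUNCTIONAL IS `−2×` THE BOND SUM, `L ≥ 3`**: for a Hermitian 1-matrix
and every `Γ`, `Re E_{t′,U}(γ, Γ) − Re E_{t,U}(γ, Γ) = −2(t′ − t) · Σ_p Σ_σ Re γ_{pσ,(p+1)σ}` on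
`hubbardRingTV L · U` (the two-body table and `E_core` do not depend on `t`; the one-body table is linear
in `t`). [folklore] -/
theorem hubbardRingTV_re_rdmEnergy_sub_hopping_eq (hL : 3 ≤ L) (t t' U : ℚ) (hγ : γ.IsHermitian)
    (Γ : Matrix (Orb (Fin L) × Orb (Fin L)) (Orb (Fin L) × Orb (Fin L)) ℂ) :
    (rdmEnergy (fun p q => ((hubbardRingTV L t' U).h p q : ℂ))
        (fun p q r s => ((hubbardRingTV L t' U).eri p q r s : ℂ)) ((hubbardRingTV L t' U).ecore : ℂ) γ Γ).re -
      (rdmEnergy (fun p q => ((hubbardRingTV L t U).h p q : ℂ))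
        (fun p q r s => ((hubbardRingTV L t U).eri p q r s : ℂ)) ((hubbardRingTV L t U).ecore : ℂ) γ Γ).re =
      -2 * ((t' : ℝ) - t) * ∑ p : Fin L, ∑ σ : Fin 2, (γ (orb p σ) (orb (finRotate L p) σ)).re := by
  rw [← Complex.sub_re, hubbardRingTV_rdmEnergy_sub_hopping, hubbardRingTV_oneBody_eq hL (t' - t) 0 γ,
    ← Complex.ofReal_ratCast, ← Complex.ofReal_neg, Complex.re_ofReal_mul, Complex.re_sum]
  simp_rw [Complex.re_sum, re_bond_add_bond_of_isHermitian hγ, ← Finset.mul_sum]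
  push_cast
  ring

end Functional

/-! ## §2 The supergradient inequality in `t` and the slope sandwich -/

section Supergradient

variable {L : ℕ} {γ : Matrix (Orb (Fin L)) (Orb (Fin L)) ℂ}
  {Γ : Matrix (Orb (Fin L) × Orb (Fin L)) (Orb (Fin L) × Orb (Fin L)) ℂ}

/-- **DANSKIN IN THE HOPPING, SECTOR LEVEL, `L ≥ 3`.** If `(γ, Γ)` is feasible for the `(a, b)` sector
programme and OPTIMAL at hopping `t` (`Re E_{t,U}(γ, Γ) = OPT_DQG(L; t, U; a, b)`), then `−2×` its bond
sum is a SUPERGRADIENT of `t ↦ OPT_DQG(L; t, U; a, b)`: for every `t′`,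
`OPT_DQG(t′) ≤ OPT_DQG(t) − 2(t′ − t)·Σ_p Σ_σ Re γ_{pσ,(p+1)σ}` (the same pair is feasible at `t′`).
[folklore] -/
theorem hubbardRingTV_pqgSectorEnergy_le_sub_mul_bond (hL : 3 ≤ L) (t t' U : ℚ) {a b : ℕ}
    (hf : IsDQGFeasibleSector a b γ Γ)
    (hopt : (rdmEnergy (fun p q => ((hubbardRingTV L t U).h p q : ℂ))
        (fun p q r s => ((hubbardRingTV L t U).eri p q r s : ℂ)) ((hubbardRingTV L t U).ecore : ℂ) γ Γ).re =
      Model.pqgSectorEnergy (hubbardRingTV L t U) a b) :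
    Model.pqgSectorEnergy (hubbardRingTV L t' U) a b ≤
      Model.pqgSectorEnergy (hubbardRingTV L t U) a b -
        2 * ((t' : ℝ) - t) * ∑ p : Fin L, ∑ σ : Fin 2, (γ (orb p σ) (orb (finRotate L p) σ)).re := by
  have h := hubbardRingTV_re_rdmEnergy_sub_hopping_eq hL t t' U hf.dqg.herm_one Γ
  have hle := pqgSectorEnergy_le_rdmEnergy (fun p q => ((hubbardRingTV L t' U).h p q : ℂ))
    (fun p q r s => ((hubbardRingTV L t' U).eri p q r s : ℂ)) ((hubbardRingTV L t' U).ecore : ℂ) hf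
  unfold Model.pqgSectorEnergy at hopt ⊢
  linarith

/-- **DANSKIN IN THE HOPPING, SINGLET LEVEL, `L ≥ 3`**: the same for the singlet-restricted programme
(`IsDQGFeasibleSinglet n`, value `OPT_DQG+S²`). [folklore] -/
theorem hubbardRingTV_pqgSingletEnergy_le_sub_mul_bond (hL : 3 ≤ L) (t t' U : ℚ) {n : ℕ}
    (hf : IsDQGFeasibleSinglet n γ Γ)
    (hopt : (rdmEnergy (fun p q => ((hubbardRingTV L t U).h p q : ℂ))
        (fun p q r s => ((hubbardRingTV L t U).eri p q r s : ℂ)) ((hubbardRingTV L t U).ecore : ℂ) γ Γ).re =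
      Model.pqgSingletEnergy (hubbardRingTV L t U) n) :
    Model.pqgSingletEnergy (hubbardRingTV L t' U) n ≤
      Model.pqgSingletEnergy (hubbardRingTV L t U) n -
        2 * ((t' : ℝ) - t) * ∑ p : Fin L, ∑ σ : Fin 2, (γ (orb p σ) (orb (finRotate L p) σ)).re := by
  have h := hubbardRingTV_re_rdmEnergy_sub_hopping_eq hL t t' U hf.dqg.herm_one Γ
  have hle := pqgSingletEnergy_le_rdmEnergy (fun p q => ((hubbardRingTV L t' U).h p q : ℂ))
    (fun p q r s => ((hubbardRingTV L t' U).eri p q r s : ℂ)) ((hubbardRingTV L t' U).ecore : ℂ) hf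
  unfold Model.pqgSingletEnergy at hopt ⊢
  linarith

/-- **THE RIGHT DIFFERENCE QUOTIENT IN `t` IS BELOW `−2×` THE BOND SUM** (`t < t′`):
`(OPT_DQG(t′) − OPT_DQG(t))/(t′ − t) ≤ −2·Σ_p Σ_σ Re γ_{pσ,(p+1)σ}` at a pair optimal at `t`. [folklore] -/
theorem hubbardRingTV_pqgSectorEnergy_tslope_le (hL : 3 ≤ L) {t t' : ℚ} (htt' : t < t') (U : ℚ) {a b : ℕ}
    (hf : IsDQGFeasibleSector a b γ Γ)
    (hopt : (rdmEnergy (fun p q => ((hubbardRingTV L t U).h p q : ℂ))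
        (fun p q r s => ((hubbardRingTV L t U).eri p q r s : ℂ)) ((hubbardRingTV L t U).ecore : ℂ) γ Γ).re =
      Model.pqgSectorEnergy (hubbardRingTV L t U) a b) :
    (Model.pqgSectorEnergy (hubbardRingTV L t' U) a b - Model.pqgSectorEnergy (hubbardRingTV L t U) a b) /
        ((t' : ℝ) - t) ≤
      -2 * ∑ p : Fin L, ∑ σ : Fin 2, (γ (orb p σ) (orb (finRotate L p) σ)).re := by
  have hpos : (0 : ℝ) < (t' : ℝ) - t := by
    have : ((t : ℚ) : ℝ) < t' := by exact_mod_cast htt'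
    linarith
  rw [div_le_iff₀ hpos]
  have h := hubbardRingTV_pqgSectorEnergy_le_sub_mul_bond hL t t' U hf hopt
  nlinarith

/-- **THE LEFT DIFFERENCE QUOTIENT IN `t` IS ABOVE `−2×` THE BOND SUM** (`t″ < t`):
`−2·Σ_p Σ_σ Re γ_{pσ,(p+1)σ} ≤ (OPT_DQG(t) − OPT_DQG(t″))/(t − t″)` at a pair optimal at `t`. [folklore] -/
theorem hubbardRingTV_le_pqgSectorEnergy_tslope (hL : 3 ≤ L) {t'' t : ℚ} (htt : t'' < t) (U : ℚ) {a b : ℕ}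
    (hf : IsDQGFeasibleSector a b γ Γ)
    (hopt : (rdmEnergy (fun p q => ((hubbardRingTV L t U).h p q : ℂ))
        (fun p q r s => ((hubbardRingTV L t U).eri p q r s : ℂ)) ((hubbardRingTV L t U).ecore : ℂ) γ Γ).re =
      Model.pqgSectorEnergy (hubbardRingTV L t U) a b) :
    -2 * ∑ p : Fin L, ∑ σ : Fin 2, (γ (orb p σ) (orb (finRotate L p) σ)).re ≤
      (Model.pqgSectorEnergy (hubbardRingTV L t U) a b - Model.pqgSectorEnergy (hubbardRingTV L t'' U) a b) /
        ((t : ℝ) - t'') := by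
  have hpos : (0 : ℝ) < (t : ℝ) - t'' := by
    have : ((t'' : ℚ) : ℝ) < t := by exact_mod_cast htt
    linarith
  rw [le_div_iff₀ hpos]
  have h := hubbardRingTV_pqgSectorEnergy_le_sub_mul_bond hL t t'' U hf hopt
  nlinarith

end Supergradient

/-! ## §3 Consequences: optimal bond sums are non-decreasing in `t` and have the sign of `t` (even `L`) -/

section Consequences

variable {L : ℕ} {γ γ' : Matrix (Orb (Fin L)) (Orb (Fin L)) ℂ}
  {Γ Γ' : Matrix (Orb (Fin L) × Orb (Fin L)) (Orb (Fin L) × Orb (Fin L)) ℂ}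

/-- **OPTIMAL BOND SUMS ARE NON-DECREASING IN THE HOPPING, `L ≥ 3`**: if `(γ, Γ)` is optimal at `t` and
`(γ′, Γ′)` is optimal at `t′ > t` (same `U`, same sector), then
`Σ_p Σ_σ Re γ_{pσ,(p+1)σ} ≤ Σ_p Σ_σ Re γ′_{pσ,(p+1)σ}` (supergradients of the concave function
`t ↦ OPT_DQG(t)` are non-increasing, and the supergradient is `−2×` the bond sum). [folklore] -/
theorem hubbardRingTV_optimal_bond_monotone (hL : 3 ≤ L) {t t' : ℚ} (htt' : t < t') (U : ℚ) {a b : ℕ}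
    (hf : IsDQGFeasibleSector a b γ Γ)
    (hopt : (rdmEnergy (fun p q => ((hubbardRingTV L t U).h p q : ℂ))
        (fun p q r s => ((hubbardRingTV L t U).eri p q r s : ℂ)) ((hubbardRingTV L t U).ecore : ℂ) γ Γ).re =
      Model.pqgSectorEnergy (hubbardRingTV L t U) a b)
    (hf' : IsDQGFeasibleSector a b γ' Γ')
    (hopt' : (rdmEnergy (fun p q => ((hubbardRingTV L t' U).h p q : ℂ))
        (fun p q r s => ((hubbardRingTV L t' U).eri p q r s : ℂ)) ((hubbardRingTV L t' U).ecore : ℂ) γ' Γ').re =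
      Model.pqgSectorEnergy (hubbardRingTV L t' U) a b) :
    ∑ p : Fin L, ∑ σ : Fin 2, (γ (orb p σ) (orb (finRotate L p) σ)).re ≤
      ∑ p : Fin L, ∑ σ : Fin 2, (γ' (orb p σ) (orb (finRotate L p) σ)).re := by
  have h1 := hubbardRingTV_pqgSectorEnergy_le_sub_mul_bond hL t t' U hf hopt
  have h2 := hubbardRingTV_pqgSectorEnergy_le_sub_mul_bond hL t' t U hf' hopt'
  have hpos : (0 : ℝ) < (t' : ℝ) - t := by
    have : ((t : ℚ) : ℝ) < t' := by exact_mod_cast htt'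
    linarith
  nlinarith

/-- **AT AN OPTIMAL PAIR THE BOND SUM HAS THE SIGN OF `t` (even `L ≥ 4`)**: `0 ≤ t·Σ_p Σ_σ Re γ_{pσ,(p+1)σ}`
for every pair optimal at `(t, U)` in a sector `a, b ≤ L` — the supergradient inequality towards `t′ = 0`
and `OPT_DQG(L; t, U) ≤ OPT_DQG(L; 0, U)` (gen 37's `hubbardRingTV_pqgSectorEnergy_le_zero_hopping`, the
sublattice gauge of the even ring). [folklore] -/
theorem hubbardRingTV_optimal_mul_bond_nonneg (hL : 3 ≤ L) (hLe : Even L) (t U : ℚ) {a b : ℕ} (ha : a ≤ L)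
    (hb : b ≤ L) (hf : IsDQGFeasibleSector a b γ Γ)
    (hopt : (rdmEnergy (fun p q => ((hubbardRingTV L t U).h p q : ℂ))
        (fun p q r s => ((hubbardRingTV L t U).eri p q r s : ℂ)) ((hubbardRingTV L t U).ecore : ℂ) γ Γ).re =
      Model.pqgSectorEnergy (hubbardRingTV L t U) a b) :
    0 ≤ (t : ℝ) * ∑ p : Fin L, ∑ σ : Fin 2, (γ (orb p σ) (orb (finRotate L p) σ)).re := by
  have h1 := hubbardRingTV_pqgSectorEnergy_le_sub_mul_bond hL t 0 U hf hopt
  have h2 := hubbardRingTV_pqgSectorEnergy_le_zero_hopping hLe ha hb t U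
  push_cast at h1
  nlinarith

/-- **EXISTENCE FORM**: for every `t, U`, `a, b ≤ L`, `L ≥ 3` there is an OPTIMAL pair of the sector
programme, and at ANY optimal pair the two one-sided `t`-difference quotients of `OPT_DQG` sandwich `−2×`
its bond sum (`∂⁺_t OPT ≤ −2K(γ*) ≤ ∂⁻_t OPT`); recorded as the existence of a pair satisfying the
supergradient inequality for all `t′`. [folklore] -/
theorem hubbardRingTV_exists_optimal_bond_supergradient (hL : 3 ≤ L) (t U : ℚ) {a b : ℕ} (ha : a ≤ L)
    (hb : b ≤ L) :
    ∃ γ Γ, IsDQGFeasibleSector a b γ Γ ∧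
      (rdmEnergy (fun p q => ((hubbardRingTV L t U).h p q : ℂ))
        (fun p q r s => ((hubbardRingTV L t U).eri p q r s : ℂ)) ((hubbardRingTV L t U).ecore : ℂ) γ Γ).re =
        Model.pqgSectorEnergy (hubbardRingTV L t U) a b ∧
      ∀ t' : ℚ, Model.pqgSectorEnergy (hubbardRingTV L t' U) a b ≤
        Model.pqgSectorEnergy (hubbardRingTV L t U) a b -
          2 * ((t' : ℝ) - t) * ∑ p : Fin L, ∑ σ : Fin 2, (γ (orb p σ) (orb (finRotate L p) σ)).re := by
  have ha' : a ≤ Fintype.card (Fin L) := by rw [Fintype.card_fin]; exact ha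
  have hb' : b ≤ Fintype.card (Fin L) := by rw [Fintype.card_fin]; exact hb
  obtain ⟨γ, Γ, hf, hE⟩ := exists_isDQGFeasibleSector_rdmEnergy_eq_pqgSectorEnergy
    (fun p q => ((hubbardRingTV L t U).h p q : ℂ))
    (fun p q r s => ((hubbardRingTV L t U).eri p q r s : ℂ)) ((hubbardRingTV L t U).ecore : ℂ) ha' hb'
  exact ⟨γ, Γ, hf, hE, fun t' => hubbardRingTV_pqgSectorEnergy_le_sub_mul_bond hL t t' U hf hE⟩

end Consequences

/-! ## §4 The exact side: Feynman–Hellmann in `t` for the half-filled ground state -/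

section GroundState

variable {n : ℕ} {t U : ℚ} {ψ : Fock (Orb (Fin (2 * n)))}

/-- **`⟨ψ, H(t′,U) ψ⟩ = ⟨ψ, H(t,U) ψ⟩ − (t′ − t)·2n·4·B`** for a ground state `ψ` of `hubbardRingTV (2n) t U`
(`n ≥ 2`, `t ≠ 0`, `U > 0`; `B = ⟨c†_{p₀σ₀} c_{(p₀+1)σ₀}⟩_ψ` at any site and spin): the Hamiltonian is
affine in `t` with slope the hopping operator, whose ground-state expectation is `−8n·B`. [folklore] -/
theorem hubbardRingTV_groundState_expect_hopping_pencil (hn : 2 ≤ n) (ht : t ≠ 0) (hU : 0 < U)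
    (hψ : IsGroundState (hubbardRingTV (2 * n) t U).hamiltonian (2 * n) ψ) (t' : ℚ) (p₀ : Fin (2 * n))
    (σ₀ : Fin 2) :
    expect (hubbardRingTV (2 * n) t' U).hamiltonian ψ =
      expect (hubbardRingTV (2 * n) t U).hamiltonian ψ -
        (((t' : ℚ) : ℂ) - (t : ℂ)) * (((2 * n : ℕ) : ℂ) * (4 *
          expect (creation (orb p₀ σ₀) * annihilation (orb (finRotate (2 * n) p₀) σ₀)) ψ)) := by
  have hn1 : 1 ≤ n := by omega
  have hbond : ∑ x : Fin (2 * n), ∑ σ : Fin 2,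
      (expect (creation (orb x σ) * annihilation (orb (finRotate (2 * n) x) σ)) ψ +
        expect (creation (orb (finRotate (2 * n) x) σ) * annihilation (orb x σ)) ψ) =
      ((2 * n : ℕ) : ℂ) * (4 * expect (creation (orb p₀ σ₀) * annihilation (orb (finRotate (2 * n) p₀) σ₀)) ψ) := by
    rw [Finset.sum_congr rfl fun x _ => Finset.sum_congr rfl fun σ _ => by
      rw [hubbardRingTV_groundState_bond_reverse hn1 ht hU hψ x σ,
        hubbardRingTV_groundState_bond_eq hn1 ht hU hψ x p₀ σ σ₀]]
    simp only [Finset.sum_const, Finset.card_univ, Fintype.card_fin, nsmul_eq_mul]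
    push_cast
    ring
  rw [hubbardRingTV_expect_eq (by omega) t' U ψ, hubbardRingTV_expect_eq (by omega) t U ψ, hbond]
  ring

/-- **FEYNMAN–HELLMANN IN THE HOPPING.** For a UNIT ground state `ψ` of `hubbardRingTV (2n) t U`
(`n ≥ 2`, `t ≠ 0`, `U > 0`) and every `t′`:
`E₀(2n; t′, U; n, n) ≤ E₀(2n; t, U; n, n) − (t′ − t)·8n·Re⟨c†_{p₀σ₀} c_{(p₀+1)σ₀}⟩_ψ` — `−8n·B` is a
supergradient of the concave function `t ↦ E₀(2n; t, U; n, n)` at `t` (`ψ` lies in the `(n, n)` sector by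
Lieb's theorem and is a trial state at `t′`). [folklore] -/
theorem hubbardRingTV_energy_le_sub_mul_bond (hn : 2 ≤ n) (ht : t ≠ 0) (hU : 0 < U)
    (hψ : IsGroundState (hubbardRingTV (2 * n) t U).hamiltonian (2 * n) ψ) (hψ1 : star ψ ⬝ᵥ ψ = 1) (t' : ℚ)
    (p₀ : Fin (2 * n)) (σ₀ : Fin 2) :
    Model.energy (hubbardRingTV (2 * n) t' U) n n ≤
      Model.energy (hubbardRingTV (2 * n) t U) n n -
        ((t' : ℝ) - t) * (8 * n * (expect (creation (orb p₀ σ₀) * annihilation (orb (finRotate (2 * n) p₀) σ₀)) ψ).re) := by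
  have hn1 : 1 ≤ n := by omega
  have hsec := hubbardRingTV_groundState_isInSector hn1 ht hU hψ
  -- the energy at `t` of the unit ground state
  have hEt : (expect (hubbardRingTV (2 * n) t U).hamiltonian ψ).re = Model.energy (hubbardRingTV (2 * n) t U) n n := by
    rw [Literature.MathematicalPhysics.QuantumLattice.expect, hψ.2.2, dotProduct_smul, hψ1, smul_eq_mul, mul_one,
      Complex.ofReal_re, hubbardRingTV_groundEnergy_eq_energy]
  -- Rayleigh–Ritz at `t′`
  have hRR : Model.energy (hubbardRingTV (2 * n) t' U) n n ≤ (expect (hubbardRingTV (2 * n) t' U).hamiltonian ψ).re := by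
    refine sectorGroundEnergy_le_of_rayleigh (hubbardRingTV_hamiltonian_isHermitian (2 * n) t' U) hsec hψ.2.1 ?_
    rw [hψ1, Complex.one_re, mul_one]
    exact le_of_eq rfl
  have h := congrArg Complex.re (hubbardRingTV_groundState_expect_hopping_pencil hn ht hU hψ t' p₀ σ₀)
  rw [Complex.sub_re, hEt, ← Complex.ofReal_ratCast, ← Complex.ofReal_ratCast] at h
  simp only [Complex.sub_re, Complex.sub_im, Complex.mul_re, Complex.ofReal_re, Complex.ofReal_im,
    Complex.natCast_re, Complex.natCast_im, Complex.re_ofNat, Complex.im_ofNat, Complex.mul_im, zero_mul,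
    sub_zero, add_zero] at h
  rw [h] at hRR
  push_cast at hRR ⊢
  linarith

/-- **THE GROUND-STATE BOND AMPLITUDE IS NON-DECREASING IN THE HOPPING**: for unit ground states `ψ` at
`(t, U)` and `φ` at `(t′, U)` with `t < t′` (both `≠ 0`; `U > 0`; `n ≥ 2`),
`Re⟨c†_{pσ} c_{(p+1)σ}⟩_ψ ≤ Re⟨c†_{pσ} c_{(p+1)σ}⟩_φ` (supergradients of a concave function are monotone).
[folklore] -/
theorem hubbardRingTV_groundState_bond_monotone (hn : 2 ≤ n) {t t' : ℚ} (ht : t ≠ 0) (ht' : t' ≠ 0)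
    (htt' : t < t') (hU : 0 < U) (hψ : IsGroundState (hubbardRingTV (2 * n) t U).hamiltonian (2 * n) ψ)
    (hψ1 : star ψ ⬝ᵥ ψ = 1) {φ : Fock (Orb (Fin (2 * n)))}
    (hφ : IsGroundState (hubbardRingTV (2 * n) t' U).hamiltonian (2 * n) φ) (hφ1 : star φ ⬝ᵥ φ = 1)
    (p : Fin (2 * n)) (σ : Fin 2) :
    (expect (creation (orb p σ) * annihilation (orb (finRotate (2 * n) p) σ)) ψ).re ≤
      (expect (creation (orb p σ) * annihilation (orb (finRotate (2 * n) p) σ)) φ).re := by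
  have h1 := hubbardRingTV_energy_le_sub_mul_bond hn ht hU hψ hψ1 t' p σ
  have h2 := hubbardRingTV_energy_le_sub_mul_bond hn ht' hU hφ hφ1 t p σ
  have hpos : (0 : ℝ) < (t' : ℝ) - t := by
    have : ((t : ℚ) : ℝ) < t' := by exact_mod_cast htt'
    linarith
  have hn' : (0 : ℝ) < n := by exact_mod_cast (by omega : 0 < n)
  have key : 0 ≤ (((t' : ℝ) - t) * (8 * n)) *
      ((expect (creation (orb p σ) * annihilation (orb (finRotate (2 * n) p) σ)) φ).re -
        (expect (creation (orb p σ) * annihilation (orb (finRotate (2 * n) p) σ)) ψ).re) := by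
    linarith
  have hc : (0 : ℝ) < ((t' : ℝ) - t) * (8 * n) := by positivity
  exact sub_nonneg.1 ((mul_nonneg_iff_of_pos_left hc).1 key)

end GroundState

end RingEnergy

end Summit.Ventures.CertifiedQuantumChemistry

end
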